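import Summits.Langlands.Langlands.Statement
import Literature.NumberTheory.Automorphic.PotentialAutomorphyGL2OrdinaryWeightTwo
import Literature.FieldTheory.AlgClosed.PadicAlgClEquivComplex
import HarnessLib

/-!
# F4 `_onpath` — `Langlands → OrdinaryPotentialAutomorphyEveryWeight` (line
# `OrdinaryPotentialAutomorphyEveryWeight`, crux `ReciprocityUpToIrreducibility`, item stmt-Langlands-14328;
# G4 ladder-down generation 36)

Self-contained, sorry-free: the declarations of §§1–4 of `Lines/OrdinaryPotentialAutomorphyEveryWeight.lean`
and the on-path lemma
`OrdinaryPotentialAutomorphyEveryWeight_of_Langlands : Langlands → OrdinaryPotentialAutomorphyEveryWeight`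
(indeed `family_of_langlands : Langlands → OrdinaryPotentialAutomorphy θ` for every `θ`): clause (B) of the
summit at any reciprocity datum (one exists by the `Nonempty` conjunct) applies to every `ρ` of the cell —
the cell's local clause is stated against the PINNED Fontaine datum `fontainePstAdicCompletion v p hv =
Rec.pst p v hv` (`rfl`) and contains de Rham, so `IsGeometricFramed Rec ρ`; `Corresponds Rec ι π ρ` contains
a.e. Satake–Frobenius matching in the summit's normalisation; an `ι : ℚ̄_p ≃ ℂ` exists
(`PadicAlgCl.nonempty_ringEquiv_complex`, Steinitz); and automorphy over `F` is potential automorphy with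
`F' := F` (`potentiallyAutomorphicAE_of_self`: restriction along `Algebra.id` is an inner automorphism).
-/

noncomputable section

set_option linter.dupNamespace false

open scoped MatrixGroups Matrix NumberField Classical
open NumberField IsDedekindDomain Field Filter
open Literature.NumberTheory.Automorphic Literature.NumberTheory.GaloisRepresentations
open Literature.NumberTheory.PAdicHodge
open Summit.Langlands

namespace Summit.Langlands.Langlands.Cruxes.ReciprocityUpToIrreducibility.OrdinaryPotentialAutomorphyEveryWeight

/-! ## 1. The dial clause -/

/-- The **weight clause** of the dial (the ONE hypothesis that moves): `θ = 0` — the weight is `2`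
(Thorne 2026 Thm. B verbatim, the tree's fact); `θ ≥ 1` — any weight `k ≥ 2`. -/
def weightClause : ℕ → ℕ → Prop
  | 0, k => k = 2
  | _ + 1, k => 2 ≤ k

theorem weightClause_zero_iff (k : ℕ) : weightClause 0 k ↔ k = 2 := Iff.rfl

theorem weightClause_succ_iff (θ k : ℕ) : weightClause (θ + 1) k ↔ 2 ≤ k := Iff.rfl

/-- The clause only weakens as `θ` grows. -/
theorem weightClause_mono {θ θ' : ℕ} (hle : θ ≤ θ') {k : ℕ} (h : weightClause θ k) :
    weightClause θ' k := by
  cases θ' with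
  | zero =>
    have : θ = 0 := Nat.le_zero.mp hle
    subst this; exact h
  | succ j =>
    cases θ with
    | zero =>
      have hk : k = 2 := h
      show 2 ≤ k
      omega
    | succ i => exact h

/-! ## 2. The hypotheses, the conclusion, the family, the rung -/

/-- **Local hypothesis above `p`** (verbatim from the fact, with the weight `2` replaced by `k`): at every
`v ∣ p`, `ρ|Γ_{F_v}` is ORDINARY OF WEIGHT `k` (`ρ|I_v ∼ (θ₁ ∗ ; 0 θ₂)`, `θ₁^m = χ_p^{(k-1)m}`, `θ₂^m = 1`)
for some `m > 0`, de Rham for the PINNED Fontaine datum, and potentially crystalline (`N = 0`). -/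
def OrdinaryLocalHyp (F : Type) [Field F] [NumberField F] (p : ℕ) [Fact p.Prime]
    (ρ : FramedGaloisRep F (PadicAlgCl p) 2) (k : ℕ) : Prop :=
  ∀ (v : HeightOneSpectrum (𝓞 F)) (hv : ((p : ℕ) : 𝓞 F) ∈ v.asIdeal),
    ∃ m : ℕ, 0 < m ∧ FramedGaloisRep.IsOrdinaryOfWeightAt p ρ v k m ∧
      (fontainePstAdicCompletion v p hv).IsDeRhamFramed (ρ.toLocal v) ∧
      ∀ r, (fontainePstAdicCompletion v p hv).IsWeilDeligneOf (ρ.toLocal v) r → r.N = 0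

/-- **Conclusion shape** (verbatim from the fact, minus its `T.IsRegular` conjunct): `ρ` is POTENTIALLY
automorphic — a finite totally real `F'/F`, an `ι : ℚ̄_p ≃ ℂ`, and for every admissible level structure a
cuspidal `L`-algebraic `π` of `GL₂(𝔸_{F'})` with `char ρ|_{Γ_{F'}}(Frob_w) =` the Satake polynomial of `π_w`
at almost every `w` (the summit's normalisation `m = 1`). -/
def PotentiallyAutomorphicAE (F : Type) [Field F] [NumberField F] (p : ℕ) [Fact p.Prime]
    (ρ : FramedGaloisRep F (PadicAlgCl p) 2) : Prop :=
  ∃ (F' : Type) (_ : Field F') (_ : NumberField F') (_ : Algebra F F'),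
    IsTotallyReal F' ∧ ∃ ι : PadicAlgCl p ≃+* ℂ,
      ∀ hF' : isCompact_glFiniteIntegralLevel 2 F',
        ∃ π : CuspidalAutomorphicRepData 2 F' hF', π.1.IsLAlgebraic ∧
          SatakeFrobCompatibleAE ι π.1 (ρ.restrictField F')

/-- **The rung family** `E(θ)`: residually-unrestricted potential automorphy for `GL₂` over totally real
`F`, every prime `p`, for irreducible, a.e.-unramified, totally odd `ρ`, ordinary of weight `k` and
potentially crystalline above `p`, with `weightClause θ k`.
`θ = 0` IN THE TREE (Thorne 2026 Thm. B); `θ ≥ 1` OPEN.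
[cite: arXiv:2608.07186, Thm. B, Thm. 3.2, Thm. 4.1] [cite: SkinnerWiles1999, Thm. A/B §4.5, p. 8] -/
def OrdinaryPotentialAutomorphy (θ : ℕ) : Prop :=
  ∀ (F : Type) [Field F] [NumberField F], IsTotallyReal F →
    ∀ (p : ℕ) [Fact p.Prime] (ρ : FramedGaloisRep F (PadicAlgCl p) 2) (k : ℕ),
      weightClause θ k →
      ρ.toGaloisRep.IsIrreducible →
      (∀ᶠ v : HeightOneSpectrum (𝓞 F) in cofinite, ρ.IsUnramifiedAt v) →
      OrdinaryLocalHyp F p ρ k → ρ.IsOdd →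
      PotentiallyAutomorphicAE F p ρ

/-- **THE RUNG** (the filed statement): the family at `θ = 1` — Thorne's residually-unrestricted ordinary
potential automorphy over totally real fields in EVERY weight `k ≥ 2`.  OPEN. -/
def OrdinaryPotentialAutomorphyEveryWeight : Prop := OrdinaryPotentialAutomorphy 1

theorem rung_iff_family_one :
    OrdinaryPotentialAutomorphyEveryWeight ↔ OrdinaryPotentialAutomorphy 1 := Iff.rfl

/-! ## 3. (F2) Monotonicity: a higher cell implies every lower cell -/

theorem mono {θ θ' : ℕ} (hle : θ ≤ θ') (h : OrdinaryPotentialAutomorphy θ') :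
    OrdinaryPotentialAutomorphy θ := by
  intro F _ _ hF p _ ρ k hk
  exact h F hF p ρ k (weightClause_mono hle hk)

/-- Every cell `θ ≥ 1` is the rung (the dial is constant from `θ = 1` on). -/
theorem family_succ_iff (θ : ℕ) :
    OrdinaryPotentialAutomorphy (θ + 1) ↔ OrdinaryPotentialAutomorphyEveryWeight := by
  constructor
  · exact fun h => mono (by omega) h
  · intro h F _ _ hF p _ ρ k hk
    exact h F hF p ρ k hk

theorem floor_of_rung (h : OrdinaryPotentialAutomorphyEveryWeight) : OrdinaryPotentialAutomorphy 0 :=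
  mono (by omega) h

/-! ## 4. (F3) Floor: `θ = 0` is the tree's named fact (Thorne 2026, Theorem B) -/

/-- **FLOOR** `θ = 0` from the named fact (binders verbatim; the fact's conclusion also records a regular
infinity type, which the family's conclusion does not ask for). -/
theorem floor_zero (hT : Thorne2026_potentialAutomorphy_GL2_potCrystallineOrdinary) :
    OrdinaryPotentialAutomorphy 0 := by
  intro F _ _ hF p _ ρ k hk hirr hunr hloc hodd
  have hk2 : k = 2 := hk
  subst hk2
  obtain ⟨F', i1, i2, i3, hF', ι, hall⟩ := hT F hF p ρ hirr hunr hloc hodd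
  refine ⟨F', i1, i2, i3, hF', ι, fun hcpt => ?_⟩
  obtain ⟨π, hL, -, hS⟩ := hall hcpt
  exact ⟨π, hL, hS⟩

/-- F3 witness shape: the floor cell by `simpa` from the floor lemma. -/
example (h : Thorne2026_potentialAutomorphy_GL2_potCrystallineOrdinary) : OrdinaryPotentialAutomorphy 0 := by
  simpa using floor_zero h

/-! ## 8. The rung is a consequence of the top and of the summit (sorry-free) -/

/-- Packaging automorphy over `F` itself as POTENTIAL automorphy with `F' := F` (restriction along
`Algebra.id` is an inner automorphism of `Γ_F`, and a.e.-Satake compatibility is conjugation-invariant). -/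
theorem potentiallyAutomorphicAE_of_self {F : Type} [Field F] [NumberField F] (hF : IsTotallyReal F)
    {p : ℕ} [Fact p.Prime] (ρ : FramedGaloisRep F (PadicAlgCl p) 2) (ι : PadicAlgCl p ≃+* ℂ)
    (h : ∀ hF' : isCompact_glFiniteIntegralLevel 2 F,
      ∃ π : CuspidalAutomorphicRepData 2 F hF', π.1.IsLAlgebraic ∧ SatakeFrobCompatibleAE ι π.1 ρ) :
    PotentiallyAutomorphicAE F p ρ := by
  -- `res : Γ_F → Γ_F` along `Algebra.id` is conjugation by some `τ`
  obtain ⟨τ, hτ⟩ := absGaloisRestrict_isConj_of_algHom_holds F F (AlgHom.id F (AlgebraicClosure F))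
    id (fun σ x => rfl)
  refine ⟨F, inferInstance, inferInstance, inferInstance, hF, ι, fun hF' => ?_⟩
  obtain ⟨π, hL, hc⟩ := h hF'
  refine ⟨π, hL, ?_⟩
  have e : ρ.restrictField F = FramedRep.conj (ρ τ)⁻¹ ρ := by
    refine ContinuousMonoidHom.ext fun σ => ?_
    have h1 : absGaloisRestrict F F σ = τ⁻¹ * σ * τ :=
      calc absGaloisRestrict F F σ = τ⁻¹ * (τ * absGaloisRestrict F F σ * τ⁻¹) * τ := by group
        _ = τ⁻¹ * σ * τ := by rw [← hτ σ]; rfl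
    rw [FramedGaloisRep.restrictField_apply, FramedRep.conj_apply, h1, map_mul, map_mul, map_inv,
      inv_inv]
  rw [e, satakeFrobCompatibleAE_conj_iff]
  exact hc

/-- Clause (B) at SOME datum for every `F` (and `n = 2`) gives every cell: the local clause of the cell is
stated against the PINNED Fontaine datum `fontainePstAdicCompletion v p hv = Rec.pst p v hv` (`rfl`), so
`IsGeometricFramed Rec ρ`; `Corresponds Rec ι π ρ` contains a.e. Satake–Frobenius matching; an
`ι : ℚ̄_p ≃ ℂ` exists (Steinitz); then `F' := F`. -/
theorem family_of_clauseB (θ : ℕ)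
    (hB : ∀ (F : Type) [Field F] [NumberField F], ∃ Rec : ReciprocityData F,
      ∀ hcpt : isCompact_glFiniteIntegralLevel 2 F, GaloisToAutomorphic 2 Rec hcpt) :
    OrdinaryPotentialAutomorphy θ := by
  intro F _ _ hF p _ ρ k _hk hirr hunr hloc _hodd
  obtain ⟨Rec, hall⟩ := hB F
  have hdR : ∀ (v : HeightOneSpectrum (𝓞 F)) (hv : ((p : ℕ) : 𝓞 F) ∈ v.asIdeal),
      (Rec.pst p v hv).IsDeRhamFramed (ρ.toLocal v) := by
    intro v hv
    change (fontainePstAdicCompletion v p hv).IsDeRhamFramed (ρ.toLocal v)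
    obtain ⟨m, -, -, hdr, -⟩ := hloc v hv
    exact hdr
  have hgeo : IsGeometricFramed Rec ρ := ⟨hunr, hdR⟩
  obtain ⟨ι⟩ := PadicAlgCl.nonempty_ringEquiv_complex p
  refine potentiallyAutomorphicAE_of_self hF ρ ι fun hcpt => ?_
  obtain ⟨π, hπL, hcorr⟩ := hall hcpt p ι ρ hirr hgeo
  exact ⟨π, hπL, hcorr.1⟩


/-- `Langlands → every cell`. -/
theorem family_of_langlands (θ : ℕ) (hL : _root_.Langlands) : OrdinaryPotentialAutomorphy θ :=
  family_of_clauseB θ fun F _ _ => by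
    obtain ⟨⟨Rec⟩, hall⟩ := hL F
    exact ⟨Rec, fun hcpt => (hall Rec 2 two_pos hcpt).2⟩

/-- **F4 on-path lemma for the rung**: `Langlands → OrdinaryPotentialAutomorphyEveryWeight`. -/
@[aesop safe apply]
theorem OrdinaryPotentialAutomorphyEveryWeight_of_Langlands (hL : _root_.Langlands) :
    OrdinaryPotentialAutomorphyEveryWeight :=
  family_of_langlands 1 hL

example : _root_.Langlands → OrdinaryPotentialAutomorphyEveryWeight := by intro h; aesop

end Summit.Langlands.Langlands.Cruxes.ReciprocityUpToIrreducibility.OrdinaryPotentialAutomorphyEveryWeight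

end
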